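import Mathlib
import Summits.PneNP.PneNP.Theorems.Nc03AvoidResidualCoreCandCutNormCertificate

/-!
# The leg model: free splitting into pieces, the signed biadjacency as a bilinear form, edge-partition
additivity and the Hoeffding shape of a pair discrepancy — line «sfm-bl» (PROOF-SFM-BL §0, Lemma 1
(last sentence), Lemma 2(a), Cor 3′, Lemma 4 (set-up))

FRONTIER F-N1c; nothing here bears on P vs NP.

DEFINITION-FREE MODEL LAYER between the instance-level certificate `CandCutNorm.CutCertified I y`
(p531401; written out here VERBATIM as its defining `∀ σ φ …` statement, so that this file imports only the
route-independent certificate file p530116 and no `Theses` module) and the matrix-level bricks of the line.  A pure-CAND instance `I : LocalMap 3 n m` has, per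
output `j`, three LEGS `(j, 0), (j, 1), (j, 2) : Fin m × Fin 3` (the constant leg, the `a`-leg, the
`b`-leg), all attached on the class side to (a piece of) the class variable `c_j = I.vars j 0`.  A PIECE
STRUCTURE is any pair of maps `src : Fin m × Fin 3 → α` (class pieces), `dst : Fin m × Fin 3 → β` (data /
constant pieces) with owner maps `own₁ : α → Fin n`, `own₂ : β → Option (Fin n)` (`none` = a piece of the
constant vertex) satisfying the four compatibility hypotheses `hsrc, hz, ha, hb` below — ANY assignment of
legs to pieces of the right owner is allowed (this is the «free splitting»: PROOF-SFM-BL §0).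

* `cutCertified_of_legs` (free splitting, ℤ-level): if the LEG-LEVEL functional
  `Σ_e χ(y_{e.1})·σ′(src e)·φ′(dst e)` is `< m` for all `±1` vectors on the pieces, then `CutCertified I y`
  (specialise `σ′ := σ ∘ own₁`, `φ′ :=` «`φ` of the owner, `+1` on constant pieces»).
* `bilin_eq_sum_legs`: for `M i k = Σ_{e : src e = i, dst e = k} s e` (hypothesis `hM`, any edge type),
  `σ′ᵀ M φ′ = Σ_e s e·σ′(src e)·φ′(dst e)`; hence `cutCertified_of_matrix_cut_lt`: a real matrix-level bound
  `σ′ᵀ M_y φ′ < m` for all real `±1` vectors gives `CutCertified I y`.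
* `bilin_eq_sum_parts` (Lemma 2(a)): for an edge partition by labels `p : E → κ`, `σ′ᵀMφ′ = Σ_c σ′ᵀM_cφ′`.
* `pairSum_eq_sum_outputs` / `abs_pairSum_le_card` (Cor 3′) / `sum_legCount_sq_le` (Lemma 4 set-up): the
  discrepancy of a pair `(W₁, W₂)` is `Σ_j χ(T_j)·c_j` with `c_j = #{legs of output j from W₁ to W₂} ≤ 3`,
  so `|disc| ≤ e(W₁, W₂)` and `Σ c_j² ≤ 3·e(W₁, W₂)` — the input shape of `SfmBl.card_abs_signSum_ge_le`.
-/

namespace Summit.PneNP.PneNP.Theorems.SfmBl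

open Matrix Finset BigOperators Literature.Computability.Complexity
open Summit.PneNP.PneNP.Theorems.CandCutNorm

/-! ### Regrouping sums over endpoint fibres -/

/-- `Σ_{i∈W₁} Σ_{k∈W₂} Σ_{e : src e = i, dst e = k} g e = Σ_{e : src e ∈ W₁, dst e ∈ W₂} g e`. -/
theorem sum_sum_fiber_eq_on {α β E : Type*} [Fintype E] [DecidableEq α] [DecidableEq β]
    (src : E → α) (dst : E → β) (W₁ : Finset α) (W₂ : Finset β) (g : E → ℝ) :
    ∑ i ∈ W₁, ∑ k ∈ W₂, ∑ e ∈ Finset.univ.filter (fun e => src e = i ∧ dst e = k), g e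
      = ∑ e ∈ Finset.univ.filter (fun e => src e ∈ W₁ ∧ dst e ∈ W₂), g e := by
  classical
  have key : ∀ e : E, ∑ i ∈ W₁, ∑ k ∈ W₂, (if src e = i ∧ dst e = k then g e else 0)
      = if src e ∈ W₁ ∧ dst e ∈ W₂ then g e else 0 := by
    intro e
    by_cases h1 : src e ∈ W₁
    · rw [Finset.sum_eq_single (src e)]
      · by_cases h2 : dst e ∈ W₂
        · rw [Finset.sum_eq_single (dst e)]
          · simp [h1, h2]
          · intro k _ hk; simp [Ne.symm hk]
          · intro h; exact absurd h2 h
        · rw [if_neg (fun h => h2 h.2)]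
          exact Finset.sum_eq_zero fun k hk => by
            have : dst e ≠ k := fun h => h2 (h ▸ hk)
            simp [this]
      · intro i _ hi; exact Finset.sum_eq_zero fun k _ => by simp [Ne.symm hi]
      · intro h; exact absurd h1 h
    · rw [if_neg (fun h => h1 h.1)]
      exact Finset.sum_eq_zero fun i hi => Finset.sum_eq_zero fun k _ => by
        have : src e ≠ i := fun h => h1 (h ▸ hi)
        simp [this]
  calc ∑ i ∈ W₁, ∑ k ∈ W₂, ∑ e ∈ Finset.univ.filter (fun e => src e = i ∧ dst e = k), g e
      = ∑ i ∈ W₁, ∑ k ∈ W₂, ∑ e, (if src e = i ∧ dst e = k then g e else 0) := by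
        refine Finset.sum_congr rfl fun i _ => Finset.sum_congr rfl fun k _ => ?_
        rw [Finset.sum_filter]
    _ = ∑ i ∈ W₁, ∑ e, ∑ k ∈ W₂, (if src e = i ∧ dst e = k then g e else 0) :=
        Finset.sum_congr rfl fun i _ => Finset.sum_comm
    _ = ∑ e, ∑ i ∈ W₁, ∑ k ∈ W₂, (if src e = i ∧ dst e = k then g e else 0) := Finset.sum_comm
    _ = ∑ e, (if src e ∈ W₁ ∧ dst e ∈ W₂ then g e else 0) := Finset.sum_congr rfl fun e _ => key e
    _ = ∑ e ∈ Finset.univ.filter (fun e => src e ∈ W₁ ∧ dst e ∈ W₂), g e := by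
        rw [Finset.sum_filter]

/-! ### The signed biadjacency as a bilinear form -/

/-- For a signed multigraph (`M i k = Σ_{e : i → k} s e`): `σᵀ M φ = Σ_e s e · σ(src e) · φ(dst e)`. -/
theorem bilin_eq_sum_legs {α β E : Type*} [Fintype α] [Fintype β] [Fintype E] [DecidableEq α]
    [DecidableEq β] (src : E → α) (dst : E → β) (s : E → ℝ) (M : Matrix α β ℝ)
    (hM : ∀ i k, M i k = ∑ e ∈ Finset.univ.filter (fun e => src e = i ∧ dst e = k), s e)
    (σ : α → ℝ) (φ : β → ℝ) :
    σ ⬝ᵥ (M *ᵥ φ) = ∑ e, s e * σ (src e) * φ (dst e) := by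
  classical
  have h1 : σ ⬝ᵥ (M *ᵥ φ) = ∑ i, ∑ k, σ i * M i k * φ k := by
    simp only [dotProduct, Matrix.mulVec, Finset.mul_sum, mul_assoc]
  rw [h1]
  have h2 : ∀ i k, σ i * M i k * φ k
      = ∑ e ∈ Finset.univ.filter (fun e => src e = i ∧ dst e = k), s e * σ (src e) * φ (dst e) := by
    intro i k
    rw [hM i k, Finset.mul_sum, Finset.sum_mul]
    refine Finset.sum_congr rfl fun e he => ?_
    simp only [Finset.mem_filter, Finset.mem_univ, true_and] at he
    rw [he.1, he.2]; ring
  simp_rw [h2]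
  have h3 := sum_sum_fiber_eq_on src dst Finset.univ Finset.univ (fun e => s e * σ (src e) * φ (dst e))
  have h4 : Finset.univ.filter (fun e => src e ∈ (Finset.univ : Finset α) ∧ dst e ∈ (Finset.univ : Finset β))
      = (Finset.univ : Finset E) :=
    Finset.filter_true_of_mem fun e _ => ⟨Finset.mem_univ _, Finset.mem_univ _⟩
  rw [h4] at h3
  exact h3

/-- LEMMA 2(a) (additivity over an edge partition): if the legs are labelled by parts `p : E → κ` and
`M_c` is the signed biadjacency of part `c`, then `σᵀ M φ = Σ_c σᵀ M_c φ`.  (Hence a bound on each part's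
cut value bounds the whole: «max of a sum ≤ sum of maxima».) -/
theorem bilin_eq_sum_parts {α β E κ : Type*} [Fintype α] [Fintype β] [Fintype E] [Fintype κ]
    [DecidableEq α] [DecidableEq β] [DecidableEq κ]
    (src : E → α) (dst : E → β) (s : E → ℝ) (p : E → κ) (M : Matrix α β ℝ)
    (hM : ∀ i k, M i k = ∑ e ∈ Finset.univ.filter (fun e => src e = i ∧ dst e = k), s e)
    (Mc : κ → Matrix α β ℝ)
    (hMc : ∀ c i k, Mc c i k = ∑ e ∈ Finset.univ.filter (fun e => src e = i ∧ dst e = k ∧ p e = c), s e)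
    (σ : α → ℝ) (φ : β → ℝ) :
    σ ⬝ᵥ (M *ᵥ φ) = ∑ c, σ ⬝ᵥ (Mc c *ᵥ φ) := by
  classical
  -- part `c` is the signed multigraph with signs `s e · [p e = c]`
  have hMc' : ∀ c i k, Mc c i k
      = ∑ e ∈ Finset.univ.filter (fun e => src e = i ∧ dst e = k), (if p e = c then s e else 0) := by
    intro c i k
    rw [hMc c i k, Finset.sum_filter, Finset.sum_filter]
    refine Finset.sum_congr rfl fun e _ => ?_
    by_cases h : src e = i ∧ dst e = k
    · by_cases hp : p e = c
      · simp [h, hp]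
      · simp [h, hp]
    · have : ¬ (src e = i ∧ dst e = k ∧ p e = c) := fun h' => h ⟨h'.1, h'.2.1⟩
      simp [h, this]
  rw [bilin_eq_sum_legs src dst s M hM σ φ]
  have hc : ∀ c, σ ⬝ᵥ (Mc c *ᵥ φ) = ∑ e, (if p e = c then s e else 0) * σ (src e) * φ (dst e) :=
    fun c => bilin_eq_sum_legs src dst _ (Mc c) (hMc' c) σ φ
  simp_rw [hc]
  rw [Finset.sum_comm]
  refine Finset.sum_congr rfl fun e _ => ?_
  have : ∀ c, (if p e = c then s e else 0) * σ (src e) * φ (dst e)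
      = if p e = c then s e * σ (src e) * φ (dst e) else 0 := by
    intro c; split_ifs <;> simp
  simp_rw [this]
  rw [Finset.sum_ite_eq, if_pos (Finset.mem_univ _)]

/-- Consequence of Lemma 2(a): part-wise bounds add up. -/
theorem bilin_le_sum_of_parts {α β E κ : Type*} [Fintype α] [Fintype β] [Fintype E] [Fintype κ]
    [DecidableEq α] [DecidableEq β] [DecidableEq κ]
    (src : E → α) (dst : E → β) (s : E → ℝ) (p : E → κ) (M : Matrix α β ℝ)
    (hM : ∀ i k, M i k = ∑ e ∈ Finset.univ.filter (fun e => src e = i ∧ dst e = k), s e)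
    (Mc : κ → Matrix α β ℝ)
    (hMc : ∀ c i k, Mc c i k = ∑ e ∈ Finset.univ.filter (fun e => src e = i ∧ dst e = k ∧ p e = c), s e)
    (σ : α → ℝ) (φ : β → ℝ) (bound : κ → ℝ) (hb : ∀ c, σ ⬝ᵥ (Mc c *ᵥ φ) ≤ bound c) :
    σ ⬝ᵥ (M *ᵥ φ) ≤ ∑ c, bound c := by
  rw [bilin_eq_sum_parts src dst s p M hM Mc hMc σ φ]
  exact Finset.sum_le_sum fun c _ => hb c

/-! ### Free splitting: from the leg-level functional to `CutCertified` -/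

/-- FREE SPLITTING (PROOF-SFM-BL §0 / Lemma 1, last sentence; ℤ-level).  `I` a 3-local instance, `y` a
point; legs `(j, ℓ)`; any piece structure `(src, dst, own₁, own₂)` whose class pieces of output `j` belong
to `c_j = I.vars j 0` (`hsrc`), whose constant leg ends on a constant piece (`hz`) and whose `a`/`b` legs
end on pieces of `a_j = I.vars j 1` / `b_j = I.vars j 2` (`ha`, `hb`).  If the leg-level functional is `< m`
for ALL `±1` vectors on the pieces, then `y` is cut-certified — the conclusion is `CandCutNorm.CutCertified I y`
written out (the instance-level functional is the leg-level one at `σ′ = σ ∘ own₁`, `φ′ = φ ∘ own₂` with `+1`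
on constant pieces). -/
theorem cutCertified_of_legs {n m : ℕ} {α β : Type*} (I : LocalMap 3 n m) (y : Fin m → Bool)
    (src : Fin m × Fin 3 → α) (dst : Fin m × Fin 3 → β) (own₁ : α → Fin n) (own₂ : β → Option (Fin n))
    (hsrc : ∀ j ℓ, own₁ (src (j, ℓ)) = I.vars j 0) (hz : ∀ j, own₂ (dst (j, 0)) = none)
    (ha : ∀ j, own₂ (dst (j, 1)) = some (I.vars j 1)) (hb : ∀ j, own₂ (dst (j, 2)) = some (I.vars j 2))
    (h : ∀ (σ' : α → ℤ) (φ' : β → ℤ), (∀ p, σ' p = 1 ∨ σ' p = -1) → (∀ q, φ' q = 1 ∨ φ' q = -1) →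
      ∑ e : Fin m × Fin 3, boolSign (y e.1) * σ' (src e) * φ' (dst e) < (m : ℤ)) :
    ∀ (σ φ : Fin n → ℤ), (∀ i, σ i = 1 ∨ σ i = -1) → (∀ i, φ i = 1 ∨ φ i = -1) →
      ∑ j, boolSign (y j) * σ (I.vars j 0) * (1 + φ (I.vars j 1) + φ (I.vars j 2)) < (m : ℤ) := by
  intro σ φ hσ hφ
  let σ' : α → ℤ := fun p => σ (own₁ p)
  let φ' : β → ℤ := fun q => (own₂ q).elim 1 φ
  have hσ' : ∀ p, σ' p = 1 ∨ σ' p = -1 := fun p => hσ _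
  have hφ' : ∀ q, φ' q = 1 ∨ φ' q = -1 := by
    intro q
    simp only [φ']
    cases own₂ q with
    | none => exact Or.inl rfl
    | some v => exact hφ v
  have hh := h σ' φ' hσ' hφ'
  have key : ∀ j : Fin m, ∑ ℓ : Fin 3, boolSign (y (j, ℓ).1) * σ' (src (j, ℓ)) * φ' (dst (j, ℓ))
      = boolSign (y j) * σ (I.vars j 0) * (1 + φ (I.vars j 1) + φ (I.vars j 2)) := by
    intro j
    rw [Fin.sum_univ_three]
    have e0 : φ' (dst (j, 0)) = 1 := by simp only [φ', hz j, Option.elim]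
    have e1 : φ' (dst (j, 1)) = φ (I.vars j 1) := by simp only [φ', ha j, Option.elim]
    have e2 : φ' (dst (j, 2)) = φ (I.vars j 2) := by simp only [φ', hb j, Option.elim]
    have s0 : σ' (src (j, 0)) = σ (I.vars j 0) := by simp only [σ', hsrc]
    have s1 : σ' (src (j, 1)) = σ (I.vars j 0) := by simp only [σ', hsrc]
    have s2 : σ' (src (j, 2)) = σ (I.vars j 0) := by simp only [σ', hsrc]
    rw [e0, e1, e2, s0, s1, s2]
    ring
  rw [Fintype.sum_prod_type] at hh
  simp only [key] at hh
  exact hh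

/-- The same over `ℝ`: a bound `< m` on the REAL leg-level functional for all real `±1` vectors gives
`CutCertified I y`. -/
theorem cutCertified_of_legs_real {n m : ℕ} {α β : Type*} (I : LocalMap 3 n m) (y : Fin m → Bool)
    (src : Fin m × Fin 3 → α) (dst : Fin m × Fin 3 → β) (own₁ : α → Fin n) (own₂ : β → Option (Fin n))
    (hsrc : ∀ j ℓ, own₁ (src (j, ℓ)) = I.vars j 0) (hz : ∀ j, own₂ (dst (j, 0)) = none)
    (ha : ∀ j, own₂ (dst (j, 1)) = some (I.vars j 1)) (hb : ∀ j, own₂ (dst (j, 2)) = some (I.vars j 2))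
    (h : ∀ (σ' : α → ℝ) (φ' : β → ℝ), (∀ p, σ' p = 1 ∨ σ' p = -1) → (∀ q, φ' q = 1 ∨ φ' q = -1) →
      ∑ e : Fin m × Fin 3, ((boolSign (y e.1) : ℤ) : ℝ) * σ' (src e) * φ' (dst e) < (m : ℝ)) :
    ∀ (σ φ : Fin n → ℤ), (∀ i, σ i = 1 ∨ σ i = -1) → (∀ i, φ i = 1 ∨ φ i = -1) →
      ∑ j, boolSign (y j) * σ (I.vars j 0) * (1 + φ (I.vars j 1) + φ (I.vars j 2)) < (m : ℤ) := by
  refine cutCertified_of_legs I y src dst own₁ own₂ hsrc hz ha hb fun σ' φ' hσ' hφ' => ?_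
  have hσR : ∀ p, ((σ' p : ℤ) : ℝ) = 1 ∨ ((σ' p : ℤ) : ℝ) = -1 := fun p => by
    rcases hσ' p with h | h <;> simp [h]
  have hφR : ∀ q, ((φ' q : ℤ) : ℝ) = 1 ∨ ((φ' q : ℤ) : ℝ) = -1 := fun q => by
    rcases hφ' q with h | h <;> simp [h]
  have hh := h (fun p => ((σ' p : ℤ) : ℝ)) (fun q => ((φ' q : ℤ) : ℝ)) hσR hφR
  exact_mod_cast hh

/-- MATRIX FORM of the certificate entry point: if `M` is the signed biadjacency of the leg multigraph of
`y` over ANY piece structure (signs `χ(y_{e.1})`, hypothesis `hM`) and `σ′ᵀ M φ′ < m` for all real `±1`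
vectors on the pieces, then `CutCertified I y` (hence `y ∉ Range(I)` for pure-CAND `I`, by
`CandCutNorm.not_mem_range_of_cutCertified`). -/
theorem cutCertified_of_matrix_cut_lt {n m : ℕ} {α β : Type*} [Fintype α] [Fintype β] [DecidableEq α]
    [DecidableEq β] (I : LocalMap 3 n m) (y : Fin m → Bool)
    (src : Fin m × Fin 3 → α) (dst : Fin m × Fin 3 → β) (own₁ : α → Fin n) (own₂ : β → Option (Fin n))
    (hsrc : ∀ j ℓ, own₁ (src (j, ℓ)) = I.vars j 0) (hz : ∀ j, own₂ (dst (j, 0)) = none)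
    (ha : ∀ j, own₂ (dst (j, 1)) = some (I.vars j 1)) (hb : ∀ j, own₂ (dst (j, 2)) = some (I.vars j 2))
    (M : Matrix α β ℝ)
    (hM : ∀ i k, M i k = ∑ e ∈ Finset.univ.filter (fun e : Fin m × Fin 3 => src e = i ∧ dst e = k),
      ((boolSign (y e.1) : ℤ) : ℝ))
    (h : ∀ (σ' : α → ℝ) (φ' : β → ℝ), (∀ p, σ' p = 1 ∨ σ' p = -1) → (∀ q, φ' q = 1 ∨ φ' q = -1) →
      σ' ⬝ᵥ (M *ᵥ φ') < (m : ℝ)) :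
    ∀ (σ φ : Fin n → ℤ), (∀ i, σ i = 1 ∨ σ i = -1) → (∀ i, φ i = 1 ∨ φ i = -1) →
      ∑ j, boolSign (y j) * σ (I.vars j 0) * (1 + φ (I.vars j 1) + φ (I.vars j 2)) < (m : ℤ) := by
  refine cutCertified_of_legs_real I y src dst own₁ own₂ hsrc hz ha hb fun σ' φ' hσ' hφ' => ?_
  have := h σ' φ' hσ' hφ'
  rwa [bilin_eq_sum_legs src dst _ M hM σ' φ'] at this

/-! ### Pair discrepancies: Cor 3′ and the Hoeffding shape -/

/-- THE DISCREPANCY OF A PAIR AS A SIGNED SUM OVER OUTPUTS.  Edges `e : E` with an output map `out : E → Fin m`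
and signs `s e = χ(T (out e))` (output-shared signs).  For vertex sets `W₁, W₂`:
`Σ_{i∈W₁} Σ_{k∈W₂} M i k = Σ_j χ(T_j)·c_j` with `c_j = #{e : out e = j, src e ∈ W₁, dst e ∈ W₂}`. -/
theorem pairSum_eq_sum_outputs {α β E : Type*} {m : ℕ} [Fintype α] [Fintype β] [Fintype E]
    [DecidableEq α] [DecidableEq β] (src : E → α) (dst : E → β) (out : E → Fin m) (T : Fin m → Bool)
    (M : Matrix α β ℝ)
    (hM : ∀ i k, M i k = ∑ e ∈ Finset.univ.filter (fun e => src e = i ∧ dst e = k),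
      ((boolSign (T (out e)) : ℤ) : ℝ))
    (W₁ : Finset α) (W₂ : Finset β) :
    ∑ i ∈ W₁, ∑ k ∈ W₂, M i k
      = ∑ j : Fin m, ((Finset.univ.filter (fun e => out e = j ∧ src e ∈ W₁ ∧ dst e ∈ W₂)).card : ℝ)
          * ((boolSign (T j) : ℤ) : ℝ) := by
  classical
  have h1 : ∑ i ∈ W₁, ∑ k ∈ W₂, M i k
      = ∑ e ∈ Finset.univ.filter (fun e => src e ∈ W₁ ∧ dst e ∈ W₂), ((boolSign (T (out e)) : ℤ) : ℝ) := by
    rw [← sum_sum_fiber_eq_on src dst W₁ W₂]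
    exact Finset.sum_congr rfl fun i _ => Finset.sum_congr rfl fun k _ => (hM i k)
  rw [h1]
  -- group the edges by their output
  rw [← Finset.sum_fiberwise_of_maps_to (g := out) (t := Finset.univ) (fun e _ => Finset.mem_univ _)]
  refine Finset.sum_congr rfl fun j _ => ?_
  rw [Finset.filter_filter]
  have : ∀ e ∈ Finset.univ.filter (fun e => (src e ∈ W₁ ∧ dst e ∈ W₂) ∧ out e = j),
      ((boolSign (T (out e)) : ℤ) : ℝ) = ((boolSign (T j) : ℤ) : ℝ) := by
    intro e he
    simp only [Finset.mem_filter, Finset.mem_univ, true_and] at he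
    rw [he.2]
  rw [Finset.sum_congr rfl this, Finset.sum_const, nsmul_eq_mul]
  have hAB : Finset.univ.filter (fun e => (src e ∈ W₁ ∧ dst e ∈ W₂) ∧ out e = j)
      = Finset.univ.filter (fun e => out e = j ∧ src e ∈ W₁ ∧ dst e ∈ W₂) := by
    ext e; simp only [Finset.mem_filter, Finset.mem_univ, true_and]; tauto
  rw [hAB]

/-- COR 3′ (signed discrepancy ≤ unsigned edge count): `|Σ_{i∈W₁} Σ_{k∈W₂} M i k| ≤ e(W₁, W₂)` whenever
`|s e| ≤ 1`. -/
theorem abs_pairSum_le_card {α β E : Type*} [Fintype α] [Fintype β] [Fintype E] [DecidableEq α]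
    [DecidableEq β] (src : E → α) (dst : E → β) (s : E → ℝ) (hs : ∀ e, |s e| ≤ 1) (M : Matrix α β ℝ)
    (hM : ∀ i k, M i k = ∑ e ∈ Finset.univ.filter (fun e => src e = i ∧ dst e = k), s e)
    (W₁ : Finset α) (W₂ : Finset β) :
    |∑ i ∈ W₁, ∑ k ∈ W₂, M i k|
      ≤ ((Finset.univ.filter (fun e => src e ∈ W₁ ∧ dst e ∈ W₂)).card : ℝ) := by
  classical
  have h1 : ∑ i ∈ W₁, ∑ k ∈ W₂, M i k = ∑ e ∈ Finset.univ.filter (fun e => src e ∈ W₁ ∧ dst e ∈ W₂), s e := by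
    rw [← sum_sum_fiber_eq_on src dst W₁ W₂]
    exact Finset.sum_congr rfl fun i _ => Finset.sum_congr rfl fun k _ => (hM i k)
  rw [h1]
  calc |∑ e ∈ Finset.univ.filter (fun e => src e ∈ W₁ ∧ dst e ∈ W₂), s e|
      ≤ ∑ e ∈ Finset.univ.filter (fun e => src e ∈ W₁ ∧ dst e ∈ W₂), |s e| := Finset.abs_sum_le_sum_abs _ _
    _ ≤ ∑ e ∈ Finset.univ.filter (fun e => src e ∈ W₁ ∧ dst e ∈ W₂), (1 : ℝ) :=
        Finset.sum_le_sum fun e _ => hs e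
    _ = _ := by simp

/-- The leg counts of a pair add up to its edge count: `Σ_j c_j = e(W₁, W₂)`. -/
theorem sum_legCount_eq_card {α β E : Type*} {m : ℕ} [Fintype E] [DecidableEq α] [DecidableEq β]
    (src : E → α) (dst : E → β) (out : E → Fin m) (W₁ : Finset α) (W₂ : Finset β) :
    ∑ j : Fin m, (Finset.univ.filter (fun e => out e = j ∧ src e ∈ W₁ ∧ dst e ∈ W₂)).card
      = (Finset.univ.filter (fun e => src e ∈ W₁ ∧ dst e ∈ W₂)).card := by
  classical
  rw [Finset.card_eq_sum_card_fiberwise (f := out) (t := Finset.univ)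
    (s := Finset.univ.filter (fun e => src e ∈ W₁ ∧ dst e ∈ W₂)) (fun e _ => Finset.mem_univ _)]
  refine Finset.sum_congr rfl fun j _ => ?_
  rw [Finset.filter_filter]
  congr 1; ext e; simp only [Finset.mem_filter, Finset.mem_univ, true_and]; tauto

/-- LEMMA 4 SET-UP (output-shared signs): if every output owns at most three legs, the pair coefficients
satisfy `Σ_j c_j² ≤ 3·e(W₁, W₂)` — the variance proxy fed to `SfmBl.card_abs_signSum_ge_le`. -/
theorem sum_legCount_sq_le {α β E : Type*} {m : ℕ} [Fintype E] [DecidableEq α] [DecidableEq β]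
    (src : E → α) (dst : E → β) (out : E → Fin m)
    (hout : ∀ j : Fin m, (Finset.univ.filter (fun e => out e = j)).card ≤ 3)
    (W₁ : Finset α) (W₂ : Finset β) :
    ∑ j : Fin m, ((Finset.univ.filter (fun e => out e = j ∧ src e ∈ W₁ ∧ dst e ∈ W₂)).card : ℝ) ^ 2
      ≤ 3 * ((Finset.univ.filter (fun e => src e ∈ W₁ ∧ dst e ∈ W₂)).card : ℝ) := by
  classical
  have hc : ∀ j : Fin m, (Finset.univ.filter (fun e => out e = j ∧ src e ∈ W₁ ∧ dst e ∈ W₂)).card ≤ 3 := by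
    intro j
    refine le_trans (Finset.card_le_card ?_) (hout j)
    intro e; simp only [Finset.mem_filter, Finset.mem_univ, true_and]; exact fun h => h.1
  calc ∑ j : Fin m, ((Finset.univ.filter (fun e => out e = j ∧ src e ∈ W₁ ∧ dst e ∈ W₂)).card : ℝ) ^ 2
      ≤ ∑ j : Fin m, 3 * ((Finset.univ.filter (fun e => out e = j ∧ src e ∈ W₁ ∧ dst e ∈ W₂)).card : ℝ) := by
        refine Finset.sum_le_sum fun j _ => ?_
        have h3 : ((Finset.univ.filter (fun e => out e = j ∧ src e ∈ W₁ ∧ dst e ∈ W₂)).card : ℝ) ≤ 3 := by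
          exact_mod_cast hc j
        have h0 : (0 : ℝ) ≤ ((Finset.univ.filter (fun e => out e = j ∧ src e ∈ W₁ ∧ dst e ∈ W₂)).card : ℝ) :=
          by positivity
        nlinarith
    _ = 3 * ((Finset.univ.filter (fun e => src e ∈ W₁ ∧ dst e ∈ W₂)).card : ℝ) := by
        rw [← Finset.mul_sum, ← sum_legCount_eq_card src dst out W₁ W₂]
        push_cast; rfl

end Summit.PneNP.PneNP.Theorems.SfmBl
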